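import Mathlib
import Summits.PneNP.PneNP.Theorems.OverlapGapAlgebraSolvableImpliesStableSectionEngine
import Summits.PneNP.PneNP.Theorems.OverlapGapAlgebraSolvableImpliesStableSectionLipschitzTransferBoost
import Summits.PneNP.PneNP.Theorems.OverlapGapAlgebraSearchHardWindowLipschitzRungVariance
import Summits.PneNP.PneNP.Theorems.OverlapGapAlgebraSearchHardWindowLipschitzRungDegree
import Summits.PneNP.PneNP.Theorems.OverlapGapAlgebraSolvableImpliesStableSectionRepairLipschitz
import Summits.PneNP.PneNP.Theorems.OverlapGapAlgebraSolvableImpliesStableSectionRepairAsymptotics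
import Summits.PneNP.PneNP.Theorems.OverlapGapAlgebraSolvableImpliesStableSectionRepairMean

/-!
# Route OverlapGapAlgebra, crux `SolvableImpliesStableSection` (stmt-PneNP-2463), line `Sketch` v4:
# assembly of the block "one round of local repair"

`stub_repairAssembly` (registered stub 7 of skeleton v4, the block's assembly): for every `k ≥ 1`,
`α, η > 0`, `c > 0` and every `ν > ν₁(k, α) := 2^{-k}(e^{kα2^{-k}} - 1)`, for all large `n`
(`m = ⌊α n⌋₊`), the 1-local repair map `g₁ Φ v := [v is the first variable of an all-positive clause]`
(flip, in the all-`false` assignment, the first variable of every violated clause) is `νm`-valid at every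
splice point of the Bresler–Huang path and `ηn`-stable between consecutive splice points on at least
`e^{-cn}·#paths` of the path tuples — the CONCLUSION of the crux at `(k, α, η, ν)`, unconditionally.

Ingredients: `stub_repairLipschitz` (`g₁` is `2`-Lipschitz per single-literal change, so its `ηn`-jump
mass vanishes once `2 ≤ η n`); the mean bound `∑_Φ V_{g₁}(Φ) ≤ m · 2^{-k}((1 + 2^{-k}((1+1/n)^k-1))^m - 1) · #Inst`
(`ra_sum_indicator_le`, file `…RepairMean.lean`: a violated clause has a negative literal and all its negative literals sit on first
variables of OTHER all-positive clauses; re-randomise the clause (`stub_rerandomize`), count the fibre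
(`stub_repairClauseFibre`) and the other clauses (`stub_repairProductCount`)); its limit
(`stub_repairAsymptotics`); Efron–Stein for Lipschitz maps (`shwLip_sum_sq_dev_le`) with the maximum
clause-degree second moment (`shwL_sum_maxdeg_sq_le`) and Chebyshev from the mean (`ra_card_mul_sq_le`, same file);
the walk engine `engine_count` with the growing loss of `sissLip_numerics` / `sissLip_asy_pointwise`.
No new definitions; axioms `propext`, `Classical.choice`, `Quot.sound`.
-/

set_option linter.dupNamespace false

namespace Summit.PneNP.PneNP.Cruxes.SolvableImpliesStableSection.Sketch

open Finset Filter Asymptotics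
open scoped Classical

set_option maxHeartbeats 400000 in
/-- **Stub 7 of skeleton v4 — assembly of the block "one round of local repair": the crux's conclusion
above the one-round repair level, unconditionally.** For every `k ≥ 1`, `α, η > 0`,
`ν > 2^{-k}(e^{kα2^{-k}} - 1)` and `c > 0`, for all large `n` (`m = ⌊α n⌋₊`) some map (the repair map
`g₁`) is `νm`-valid at every splice point of the Bresler–Huang path and moves by at most `η n` between
consecutive splice points, on at least `e^{-cn}·#paths` of the path tuples. -/
theorem stub_repairAssembly (k : ℕ) (hk : 1 ≤ k) (α η ν : ℝ) (hα : 0 < α) (hη : 0 < η)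
    (hν : (1 / 2 : ℝ) ^ k * (Real.exp (k * α * (1 / 2 : ℝ) ^ k) - 1) < ν) (c : ℝ) (hc : 0 < c) :
    ∀ᶠ n : ℕ in Filter.atTop, ∀ m : ℕ, m = ⌊α * n⌋₊ →
      ∃ g : (Fin m → Fin k → Fin n × Bool) → (Fin n → Bool),
        Real.exp (-(c * n)) * Fintype.card (Fin (k + 1) → Fin m → Fin k → Fin n × Bool) ≤
        ((Finset.univ.filter fun Ψ : Fin (k + 1) → Fin m → Fin k → Fin n × Bool =>
          let P : Fin k → ℕ → Fin m → Fin k → Fin n × Bool :=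
            fun r q a b => if (a : ℕ) * k + b < q then Ψ r.succ a b else Ψ r.castSucc a b
          (∀ r : Fin k, ∀ q ≤ m * k, ((Finset.univ.filter fun i : Fin m =>
            ∀ j, g (P r q) (P r q i j).1 ≠ (P r q i j).2).card : ℝ) ≤ ν * m) ∧
          ∀ r : Fin k, ∀ q < m * k,
            (hammingDist (g (P r q)) (g (P r (q + 1))) : ℝ) ≤ η * n).card : ℝ) := by
  have hk0 : 0 < k := hk
  have hkR : (0 : ℝ) < k := by exact_mod_cast hk0
  -- the levels: limit `ν₁`, midpoint `ν'`, gap `τ`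
  set ν₁ : ℝ := (1 / 2 : ℝ) ^ k * (Real.exp (k * α * (1 / 2 : ℝ) ^ k) - 1) with hν₁
  have hν₁0 : 0 ≤ ν₁ := by
    rw [hν₁]
    refine mul_nonneg (by positivity) ?_
    have : (1 : ℝ) ≤ Real.exp (k * α * (1 / 2 : ℝ) ^ k) := Real.one_le_exp (by positivity)
    linarith
  set ν' : ℝ := (ν₁ + ν) / 2 with hν'
  set τ : ℝ := ν - ν' with hτ
  have hτpos : 0 < τ := by rw [hτ, hν']; linarith
  have hντ : ν = ν' + τ := by rw [hτ]; ring
  -- the small constant `δ` (as in the Lipschitz transfer, with `ε = 1`, `ν ↦ τ`)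
  obtain ⟨δ, hδpos, hδ1, hδa, hδc, hδb⟩ : ∃ δ : ℝ, 0 < δ ∧ δ ≤ 1 ∧
      δ ≤ 1 * τ ^ 2 * α / (160 * k ^ 2) ∧ δ ≤ c * τ ^ 2 / (1280 * k ^ 4) ∧
      δ ≤ α * τ ^ 2 / (1280 * k ^ 3) := by
    refine ⟨min 1 (min (1 * τ ^ 2 * α / (160 * k ^ 2))
      (min (c * τ ^ 2 / (1280 * k ^ 4)) (α * τ ^ 2 / (1280 * k ^ 3)))), ?_, min_le_left _ _,
      (min_le_right _ _).trans (min_le_left _ _),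
      ((min_le_right _ _).trans (min_le_right _ _)).trans (min_le_left _ _),
      ((min_le_right _ _).trans (min_le_right _ _)).trans (min_le_right _ _)⟩
    refine lt_min zero_lt_one (lt_min ?_ (lt_min ?_ ?_)) <;> positivity
  -- eventual conditions in `n`
  have C0 : ∀ᶠ n : ℕ in atTop, 3 ≤ n := eventually_ge_atTop 3
  have C1 : ∀ᶠ n : ℕ in atTop, (2 : ℝ) ^ 2 * Real.log n ^ 3 ≤ δ * n := by
    have hlo : (fun x : ℝ => Real.log x ^ 3) =o[atTop] id := Real.isLittleO_pow_log_id_atTop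
    have hlo' := hlo.comp_tendsto tendsto_natCast_atTop_atTop
    have hpos : 0 < δ / 4 := by positivity
    filter_upwards [hlo'.def hpos] with n hn
    simp only [Function.comp_apply, id_eq, Real.norm_eq_abs, Nat.abs_cast] at hn
    have h1 : Real.log n ^ 3 ≤ δ / 4 * n := (le_abs_self _).trans hn
    linarith
  have C2 := Summit.PneNP.PneNP.Theorems.shwL_sum_maxdeg_sq_le k hα.le
  have C3 : ∀ᶠ n : ℕ in atTop, (8 + 1 * τ ^ 2) * 2 / (1 * τ ^ 2 * α) ≤ (n : ℝ) :=
    tendsto_natCast_atTop_atTop.eventually_ge_atTop _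
  have C4 : ∀ᶠ n : ℕ in atTop, (1 + 32 * k ^ 2 / τ ^ 2) * Real.log n ≤ c * n / 2 := by
    have hlo := Real.isLittleO_log_id_atTop.comp_tendsto tendsto_natCast_atTop_atTop
    have hK : (0 : ℝ) < 1 + 32 * k ^ 2 / τ ^ 2 := by positivity
    have hpos : 0 < c / (2 * (1 + 32 * k ^ 2 / τ ^ 2)) := by positivity
    filter_upwards [hlo.def hpos] with n hn
    simp only [Function.comp_apply, id_eq, Real.norm_eq_abs, Nat.abs_cast] at hn
    have h1 : Real.log n ≤ c / (2 * (1 + 32 * k ^ 2 / τ ^ 2)) * n := (le_abs_self _).trans hn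
    calc (1 + 32 * k ^ 2 / τ ^ 2) * Real.log n
        ≤ (1 + 32 * k ^ 2 / τ ^ 2) * (c / (2 * (1 + 32 * k ^ 2 / τ ^ 2)) * n) :=
          mul_le_mul_of_nonneg_left h1 hK.le
      _ = c * n / 2 := by field_simp
  have C5 : ∀ᶠ n : ℕ in atTop, 2 * (16 * k ^ 2 / τ ^ 2 + 1 + k ^ 2) / (k ^ 2 * α) ≤ (n : ℝ) :=
    tendsto_natCast_atTop_atTop.eventually_ge_atTop _
  have C6 : ∀ᶠ n : ℕ in atTop, 1 / η ^ 2 ≤ (n : ℝ) :=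
    tendsto_natCast_atTop_atTop.eventually_ge_atTop _
  have C7 := stub_repairAsymptotics k hk α ν hα hν
  filter_upwards [C0, C1, C2, C3, C4, C5, C6, C7] with n hn3 hC1 hC2 hC3 hC4 hC5 hC6 hC7 m hm
  -- the repair map, opaque: only its specification is used
  obtain ⟨g, hg⟩ : ∃ g : (Fin m → Fin k → Fin n × Bool) → (Fin n → Bool),
      ∀ (Φ : Fin m → Fin k → Fin n × Bool) (v : Fin n),
        g Φ v = true ↔ ∃ a : Fin m, (Φ a ⟨0, hk0⟩).1 = v ∧ ∀ j, (Φ a j).2 = true :=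
    ⟨fun Φ v => decide (∃ a : Fin m, (Φ a ⟨0, hk0⟩).1 = v ∧ ∀ j, (Φ a j).2 = true),
      fun Φ v => by simp⟩
  refine ⟨g, ?_⟩
  -- numerics of `n` and `m`
  have hn1 : 1 ≤ n := le_trans (by norm_num) hn3
  have hnR : (1 : ℝ) ≤ n := by exact_mod_cast hn1
  have hxpos : (0 : ℝ) < 2 * n := by linarith only [hnR]
  have hlog2le : Real.log 2 ≤ Real.log (2 * n) := Real.log_le_log two_pos (by linarith only [hnR])
  have hm_le : (m : ℝ) ≤ α * n := by rw [hm]; exact Nat.floor_le (by positivity)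
  have hm_ge : α * n - 1 ≤ m := by
    rw [hm]; have := Nat.lt_floor_add_one (α * n); linarith only [this]
  have hLip : ∀ (Φ : Fin m → Fin k → Fin n × Bool) (a : Fin m) (b : Fin k) (ℓ : Fin n × Bool),
      (hammingDist (g Φ) (g (Function.update Φ a (Function.update (Φ a) b ℓ))) : ℝ) ≤ 2 :=
    fun Φ a b ℓ => stub_repairLipschitz k m n hk0 g hg Φ a b ℓ
  obtain ⟨hm1, hs'η, -, ht, hMB⟩ := Summit.PneNP.PneNP.Theorems.sissLip_numerics k hk α η τ 1 c δ 2
    hα hη hτpos one_pos hc (by norm_num) hδ1 hδa hδc hδb n m hn3 hC1 hC3 hC4 hC5 hC6 hm_ge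
  have hm0 : (0 : ℝ) < m := by exact_mod_cast hm1
  -- the loss rate `A` and the good set `G`
  obtain ⟨A, hA⟩ : ∃ A : ℝ, A = 4 * k * (1 + 10 * k ^ 2 * (2 : ℝ) ^ 2 * Real.log n ^ 2) / τ ^ 2 :=
    ⟨_, rfl⟩
  have hA0 : 0 ≤ A := by rw [hA]; positivity
  rw [← hA] at ht hMB
  set N : ℝ := (Fintype.card (Fin m → Fin k → Fin n × Bool) : ℝ) with hN
  have hN0 : 0 ≤ N := by rw [hN]; exact Nat.cast_nonneg _
  obtain ⟨G, hGdef⟩ : ∃ G : Finset (Fin m → Fin k → Fin n × Bool),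
      G = (univ : Finset (Fin m → Fin k → Fin n × Bool)).filter fun Φ =>
        ((((univ : Finset (Fin m)).filter fun i => ∀ j, g Φ (Φ i j).1 ≠ (Φ i j).2).card : ℕ) : ℝ)
          ≤ ν * m := ⟨_, rfl⟩
  have hval : ∀ Φ ∈ G, ((((univ : Finset (Fin m)).filter fun i =>
      ∀ j, g Φ (Φ i j).1 ≠ (Φ i j).2).card : ℕ) : ℝ) ≤ ν * m := fun Φ hΦ => by
    rw [hGdef] at hΦ
    exact (Finset.mem_filter.1 hΦ).2
  -- the violated-clause count, its mean and its variance
  set V : (Fin m → Fin k → Fin n × Bool) → ℝ := fun Φ =>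
    ((((univ : Finset (Fin m)).filter fun i => ∀ j, g Φ (Φ i j).1 ≠ (Φ i j).2).card : ℕ) : ℝ)
    with hV
  have hmean : ∑ Φ, V Φ ≤ ν' * m * N := by
    have h1 : ∑ Φ, V Φ = ∑ i : Fin m, ∑ Φ : Fin m → Fin k → Fin n × Bool,
        (if ∀ j, g Φ (Φ i j).1 ≠ (Φ i j).2 then (1 : ℝ) else 0) := by
      rw [Finset.sum_comm]
      refine Finset.sum_congr rfl fun Φ _ => ?_
      rw [hV]
      simp only
      rw [Finset.natCast_card_filter]
    have h2 : ∀ i : Fin m, ∑ Φ : Fin m → Fin k → Fin n × Bool,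
        (if ∀ j, g Φ (Φ i j).1 ≠ (Φ i j).2 then (1 : ℝ) else 0)
        ≤ (1 / 2 : ℝ) ^ k * N * ((1 + (1 / 2 : ℝ) ^ k * ((1 + 1 / (n : ℝ)) ^ k - 1)) ^ m - 1) :=
      fun i => ra_sum_indicator_le k m n hk0 hn1 g hg i
    have h3 : (1 / 2 : ℝ) ^ k * ((1 + (1 / 2 : ℝ) ^ k * ((1 + 1 / (n : ℝ)) ^ k - 1)) ^ m - 1)
        ≤ ν' := hC7 m hm_le
    calc ∑ Φ, V Φ = _ := h1
      _ ≤ ∑ _i : Fin m, (1 / 2 : ℝ) ^ k * N *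
            ((1 + (1 / 2 : ℝ) ^ k * ((1 + 1 / (n : ℝ)) ^ k - 1)) ^ m - 1) :=
          Finset.sum_le_sum fun i _ => h2 i
      _ = m * (((1 / 2 : ℝ) ^ k * ((1 + (1 / 2 : ℝ) ^ k * ((1 + 1 / (n : ℝ)) ^ k - 1)) ^ m - 1)) * N) := by
          rw [Finset.sum_const, Finset.card_univ, Fintype.card_fin, nsmul_eq_mul]; ring
      _ ≤ m * (ν' * N) := by
          refine mul_le_mul_of_nonneg_left ?_ (Nat.cast_nonneg _)
          exact mul_le_mul_of_nonneg_right h3 hN0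
      _ = ν' * m * N := by ring
  have hvar : ∑ Φ, (V Φ - (∑ Ψ, V Ψ) / Fintype.card (Fin m → Fin k → Fin n × Bool)) ^ 2
      ≤ m * N * (1 + 40 * k ^ 2 * Real.log n ^ 2) := by
    have h := Summit.PneNP.PneNP.Theorems.shwLip_sum_sq_dev_le hn1 g 2 (by norm_num) hLip
    have hD := hC2 m hm_le
    rw [hV]
    refine h.trans ?_
    rw [← hN] at hD ⊢
    have : (k : ℝ) ^ 2 * 2 ^ 2 * ∑ Φ : Fin m → Fin k → Fin n × Bool,
        (((univ : Finset (Fin n)).sup fun v =>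
          ((univ : Finset (Fin m)).filter fun i => ∃ j, (Φ i j).1 = v).card : ℕ) : ℝ) ^ 2
        ≤ (k : ℝ) ^ 2 * 2 ^ 2 * (10 * Real.log n ^ 2 * N) :=
      mul_le_mul_of_nonneg_left hD (by positivity)
    nlinarith [this, hm0.le, hN0]
  have hG : ((k * m : ℕ) : ℝ) * (Gᶜ.card : ℝ) ≤ A * Fintype.card (Fin m → Fin k → Fin n × Bool) := by
    have hS : ∀ Φ ∈ Gᶜ, ν' * m + τ * m < V Φ := by
      intro Φ hΦ
      rw [hGdef, Finset.mem_compl, Finset.mem_filter, not_and] at hΦ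
      have h1 := hΦ (Finset.mem_univ _)
      rw [not_le] at h1
      rw [hV]
      simp only
      calc ν' * m + τ * m = ν * m := by rw [hντ]; ring
        _ < _ := h1
    have hcheb := ra_card_mul_sq_le V (m * N * (1 + 40 * k ^ 2 * Real.log n ^ 2)) (ν' * m) (τ * m)
      (by positivity) (by rw [← hN]; linarith [hmean]) hvar Gᶜ hS
    -- (km)·#Gᶜ ≤ k·(1 + 40k² log² n)/τ² · N ≤ A · N
    rw [← hN]
    have hτm : 0 < (τ * m) ^ 2 := by positivity
    have h1 : (Gᶜ.card : ℝ) ≤ m * N * (1 + 40 * k ^ 2 * Real.log n ^ 2) / (τ * m) ^ 2 := by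
      rw [le_div_iff₀ hτm]; exact hcheb
    have h2 : ((k * m : ℕ) : ℝ) * (m * N * (1 + 40 * k ^ 2 * Real.log n ^ 2) / (τ * m) ^ 2)
        = k * (1 + 40 * k ^ 2 * Real.log n ^ 2) / τ ^ 2 * N := by
      push_cast
      field_simp
    have h3 : k * (1 + 40 * k ^ 2 * Real.log n ^ 2) / τ ^ 2 ≤ A := by
      rw [hA]
      refine div_le_div_of_nonneg_right ?_ (by positivity)
      have hd : (4 : ℝ) * k * (1 + 10 * k ^ 2 * (2 : ℝ) ^ 2 * Real.log n ^ 2)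
          - k * (1 + 40 * k ^ 2 * Real.log n ^ 2) = 3 * k + 120 * k ^ 3 * Real.log n ^ 2 := by
        ring
      have hp : (0 : ℝ) ≤ 3 * k + 120 * k ^ 3 * Real.log n ^ 2 := by positivity
      linarith
    calc ((k * m : ℕ) : ℝ) * (Gᶜ.card : ℝ)
        ≤ ((k * m : ℕ) : ℝ) * (m * N * (1 + 40 * k ^ 2 * Real.log n ^ 2) / (τ * m) ^ 2) :=
          mul_le_mul_of_nonneg_left h1 (Nat.cast_nonneg _)
      _ = k * (1 + 40 * k ^ 2 * Real.log n ^ 2) / τ ^ 2 * N := h2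
      _ ≤ A * N := mul_le_mul_of_nonneg_right h3 hN0
  -- zero jump mass: no single-literal change moves `g` by more than `2 ≤ η n`
  have hjump : (∑ a : Fin m, ∑ b : Fin k,
      (((Finset.univ : Finset ((Fin m → Fin k → Fin n × Bool) × (Fin n × Bool))).filter
        fun p => η * n < hammingDist (g p.1)
          (g (Function.update p.1 a (Function.update (p.1 a) b p.2)))).card : ℝ))
      ≤ A * (Fintype.card (Fin m → Fin k → Fin n × Bool) * (2 * n)) := by
    have hzero : ∀ (a : Fin m) (b : Fin k),
        (((Finset.univ : Finset ((Fin m → Fin k → Fin n × Bool) × (Fin n × Bool))).filter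
          fun p => η * n < hammingDist (g p.1)
            (g (Function.update p.1 a (Function.update (p.1 a) b p.2)))).card : ℝ) = 0 := by
      intro a b
      rw [Nat.cast_eq_zero, Finset.card_eq_zero, Finset.filter_eq_empty_iff]
      intro p _
      exact not_lt.2 ((hLip p.1 a b p.2).trans hs'η)
    simp only [hzero, Finset.sum_const_zero]
    positivity
  -- the engine and the growing-loss asymptotics
  have hE := engine_count k m n hn1 η A hη.le hA0 g G hG hjump
  have hasym := Summit.PneNP.PneNP.Theorems.sissLip_asy_pointwise (M := m * k) (k := k)
    (Real.exp_log hxpos) hlog2le ht hMB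
  -- assembly (as in `concl_of_smoothSection`)
  have hpaths : (Fintype.card (Fin (k + 1) → Fin m → Fin k → Fin n × Bool) : ℝ) =
      (2 * n) ^ (m * k * (k + 1)) := by
    rw [eng_card_paths]
    push_cast
    ring
  have hmono : ((univ : Finset (Fin (k + 1) → Fin m → Fin k → Fin n × Bool)).filter fun Ψ =>
          (∀ r : Fin k, ∀ q ≤ m * k,
            (fun (a : Fin m) (b : Fin k) =>
              if (a : ℕ) * k + b < q then Ψ r.succ a b else Ψ r.castSucc a b) ∈ G) ∧
          ∀ r : Fin k, ∀ q < m * k,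
            (hammingDist
              (g fun (a : Fin m) (b : Fin k) =>
                if (a : ℕ) * k + b < q then Ψ r.succ a b else Ψ r.castSucc a b)
              (g fun (a : Fin m) (b : Fin k) =>
                if (a : ℕ) * k + b < q + 1 then Ψ r.succ a b else Ψ r.castSucc a b) : ℝ)
              ≤ η * n).card ≤
      ((univ : Finset (Fin (k + 1) → Fin m → Fin k → Fin n × Bool)).filter fun Ψ =>
        let P : Fin k → ℕ → Fin m → Fin k → Fin n × Bool :=
          fun r q a b => if (a : ℕ) * k + b < q then Ψ r.succ a b else Ψ r.castSucc a b
        (∀ r : Fin k, ∀ q ≤ m * k, (((Finset.univ : Finset (Fin m)).filter fun i =>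
          ∀ j, g (P r q) (P r q i j).1 ≠ (P r q i j).2).card : ℝ) ≤ ν * m) ∧
        ∀ r : Fin k, ∀ q < m * k,
          (hammingDist (g (P r q)) (g (P r (q + 1))) : ℝ) ≤ η * n).card := by
    refine Finset.card_le_card fun Ψ hΨ => ?_
    simp only [Finset.mem_filter, Finset.mem_univ, true_and] at hΨ ⊢
    obtain ⟨hin, hjmp⟩ := hΨ
    exact ⟨fun r q hq => hval _ (hin r q hq), fun r q hq => hjmp r q hq⟩
  have hmono' := (Nat.cast_le (α := ℝ)).2 hmono
  rw [hpaths]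
  linarith only [hasym, hE, hmono']

end Summit.PneNP.PneNP.Cruxes.SolvableImpliesStableSection.Sketch
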